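import Mathlib
import HarnessLib
import Literature.Probability.LatticeModels.IsingLimitLaw
import Literature.Probability.LatticeModels.IsingLimitLawTilt
import Literature.Probability.LatticeModels.IsingLimitLawLaplace
import Literature.Analysis.Complex.PolyaBesselKernel
import Summits.RiemannHypothesis.RiemannHypothesis.Theorems.LeeYangLeeyangPolyaKernelIsingLimitDefs

/-!
# Local error of one transfer step: stub `stub_localError` of the line `telegraph-bessel-chain` (crux stmt-RiemannHypothesis-0453)

For a solution `(S, D)` of the telegraph backward system `S′ = −iyD`, `D′ = −iyS + 2rD` with
`|S| ≤ 2`, `|D(t)| ≤ |y|/(ae^t)` and a rate `ae^t ≤ r ≤ Qae^t` (`t ≥ 0`) solving the Riccati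
equation `r′ = r² − (ae^t)²`, the exact flow over `[t − η, t]` and one transfer step
`X ↦ sdStep (iyη) (e^{−2ηr(t−η)}) X = [[cos yη, ic sin yη], [i sin yη, c cos yη]] X` differ by at
most `L η² e^t` per component, `L = L(a, Q, y)` (second-order consistency of the Euler scheme).
Proof: (1) Taylor remainders `‖X(t−η) − X(t) + ηX′(t)‖ ≤ η sup_{[t−η,t]} ‖X′ − X′(t)‖` by the mean
value inequality, the oscillation of `X′` being bounded by a second mean value inequality for
`S`, `D`, `r` on the window; (2) the transfer matrix minus `1 − ηA(t)` has entries `cos x − 1`,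
`i(c sin x − x)`, `i(sin x − x)`, `c cos x − 1 + 2ηr(t)` (`x = yη`), bounded via `1 − cos x ≤ x²/2`,
`|x − sin x| ≤ |x|³/6`, `|e^{−u} − 1 + u| ≤ u²` (`u ≥ 0`), `|r(t) − r(t−η)| ≤ η sup|r′|`. Folklore.
-/

noncomputable section

namespace Summit.RiemannHypothesis.RiemannHypothesis.Theorems.LeeYangTelegraph

open MeasureTheory Filter Topology Complex
open Literature.Probability.LatticeModels Literature.Analysis.Complex.Polya1926

/-- Mean value inequality on a window `[lo, t]`, anchored at the right endpoint: a derivative bound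
`‖f′‖ ≤ C` gives `‖f u − f t‖ ≤ C (t − u)`. [folklore] -/
private theorem norm_sub_right_le_of_deriv {E : Type*} [NormedAddCommGroup E] [NormedSpace ℝ E]
    {f f' : ℝ → E} {lo t C : ℝ} (hf : ∀ u, HasDerivAt f (f' u) u)
    (hb : ∀ u ∈ Set.Icc lo t, ‖f' u‖ ≤ C) {u : ℝ} (hu : u ∈ Set.Icc lo t) :
    ‖f u - f t‖ ≤ C * (t - u) := by
  have ht : t ∈ Set.Icc lo t := ⟨hu.1.trans hu.2, le_rfl⟩
  have h := Convex.norm_image_sub_le_of_norm_hasDerivWithin_le (𝕜 := ℝ)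
    (fun x _ => (hf x).hasDerivWithinAt) hb (convex_Icc lo t) ht hu
  rwa [Real.norm_eq_abs, abs_of_nonpos (sub_nonpos.2 hu.2), neg_sub] at h

/-- First-order Taylor remainder via the mean value inequality: if `‖f′ u − f′ t‖ ≤ B` on
`[t − η, t]` then `‖f(t − η) − (f t − η f′ t)‖ ≤ B η`. [folklore] -/
private theorem norm_taylor_le_of_deriv {f f' : ℝ → ℂ} {η t B : ℝ} (hη : 0 ≤ η)
    (hf : ∀ u, HasDerivAt f (f' u) u) (hb : ∀ u ∈ Set.Icc (t - η) t, ‖f' u - f' t‖ ≤ B) :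
    ‖f (t - η) - (f t - (η : ℂ) * f' t)‖ ≤ B * η := by
  have hg : ∀ u, HasDerivAt (fun u : ℝ => f u - ((u - t : ℝ) : ℂ) * f' t) (f' u - f' t) u := by
    intro u
    have h1 : HasDerivAt (fun u : ℝ => ((u - t : ℝ) : ℂ) * f' t) (((1 : ℝ) : ℂ) * f' t) u :=
      (((hasDerivAt_id u).sub_const t).ofReal_comp).mul_const (f' t)
    simpa using (hf u).fun_sub h1
  have hmem : t ∈ Set.Icc (t - η) t := ⟨by linarith, le_rfl⟩
  have h := norm_image_sub_le_of_norm_deriv_le_segment' (fun x _ => (hg x).hasDerivWithinAt)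
    (fun x hx => hb x (Set.Ico_subset_Icc_self hx)) t hmem
  have e : (f t - ((t - t : ℝ) : ℂ) * f' t) - (f (t - η) - ((t - η - t : ℝ) : ℂ) * f' t)
      = -(f (t - η) - (f t - (η : ℂ) * f' t)) := by push_cast; ring
  rw [e, norm_neg] at h
  simpa using h

/-- `|e^{−u} − 1 + u| ≤ u²` for `u ≥ 0`. [folklore] -/
private theorem abs_exp_neg_sub_le {u : ℝ} (hu : 0 ≤ u) : |Real.exp (-u) - 1 + u| ≤ u ^ 2 := by
  rcases le_or_gt u 1 with h | h
  · have := Real.abs_exp_sub_one_sub_id_le (x := -u) (by rw [abs_neg, abs_of_nonneg hu]; exact h)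
    simpa [sub_neg_eq_add] using this
  · rw [abs_of_nonneg (by linarith [Real.add_one_le_exp (-u)])]
    have : Real.exp (-u) ≤ 1 := by rw [Real.exp_le_one_iff]; linarith
    nlinarith

/-- `cosh (iyη) = cos (yη)` and `sinh (iyη) = i sin (yη)`. [folklore] -/
private theorem cosh_sinh_I_mul (y η : ℝ) :
    Complex.cosh (I * y * η) = (Real.cos (y * η) : ℂ) ∧
      Complex.sinh (I * y * η) = (Real.sin (y * η) : ℂ) * I := by
  have e : I * y * η = ((y * η : ℝ) : ℂ) * I := by push_cast; ring
  rw [e, Complex.cosh_mul_I, Complex.sinh_mul_I, Complex.ofReal_cos, Complex.ofReal_sin]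
  exact ⟨rfl, rfl⟩

/-- Mean value inequalities for `S`, `D`, `r` on the window `[t − η, t] ⊆ [0, ∞)`:
`‖S u − S t‖ ≤ (y²/a)(t − u)`, `‖D u − D t‖ ≤ 2|y|(1 + Q)(t − u)`,
`|r u − r t| ≤ (Q a e^t)² (t − u)`, and `0 ≤ r u ≤ Q a e^t`, `‖D u‖ ≤ |y|/a`. [folklore] -/
private theorem window_mvt (a Q y : ℝ) (ha : 0 < a) (hQ : 1 ≤ Q) (S D : ℝ → ℂ) (r : ℝ → ℝ)
    (hS : ∀ t : ℝ, HasDerivAt S (-(I * y * D t)) t)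
    (hD : ∀ t : ℝ, HasDerivAt D (-(I * y * S t) + 2 * (r t : ℂ) * D t) t)
    (hr : ∀ t : ℝ, HasDerivAt r (r t ^ 2 - (a * Real.exp t) ^ 2) t)
    (hSb : ∀ t : ℝ, ‖S t‖ ≤ 2) (hDb : ∀ t : ℝ, ‖D t‖ ≤ |y| / (a * Real.exp t))
    (hr1 : ∀ t : ℝ, a * Real.exp t ≤ r t) (hr2 : ∀ t : ℝ, 0 ≤ t → r t ≤ Q * (a * Real.exp t))
    {η t : ℝ} (hηt : η ≤ t) :
    (∀ u ∈ Set.Icc (t - η) t, ‖S u - S t‖ ≤ |y| * (|y| / a) * (t - u)) ∧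
    (∀ u ∈ Set.Icc (t - η) t, ‖D u - D t‖ ≤ (2 * |y| + 2 * (Q * |y|)) * (t - u)) ∧
    (∀ u ∈ Set.Icc (t - η) t, |r u - r t| ≤ (Q * (a * Real.exp t)) ^ 2 * (t - u)) ∧
    (∀ u ∈ Set.Icc (t - η) t, 0 ≤ r u ∧ r u ≤ Q * (a * Real.exp t)) ∧
    (∀ u ∈ Set.Icc (t - η) t, ‖D u‖ ≤ |y| / a) := by
  have hQ0 : 0 ≤ Q := by linarith
  have hK : ∀ u ∈ Set.Icc (t - η) t, 0 ≤ u ∧ a ≤ a * Real.exp u ∧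
      a * Real.exp u ≤ a * Real.exp t := by
    intro u hu
    exact ⟨by linarith [hu.1], le_mul_of_one_le_right ha.le (Real.one_le_exp (by linarith [hu.1])),
      mul_le_mul_of_nonneg_left (Real.exp_le_exp.2 hu.2) ha.le⟩
  have hDu : ∀ u ∈ Set.Icc (t - η) t, ‖D u‖ ≤ |y| / a := fun u hu =>
    (hDb u).trans (div_le_div_of_nonneg_left (abs_nonneg _) ha (hK u hu).2.1)
  have hru : ∀ u ∈ Set.Icc (t - η) t, 0 ≤ r u ∧ r u ≤ Q * (a * Real.exp t) := fun u hu =>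
    ⟨(by positivity : (0 : ℝ) ≤ a * Real.exp u).trans (hr1 u),
      (hr2 u (hK u hu).1).trans (mul_le_mul_of_nonneg_left (hK u hu).2.2 hQ0)⟩
  have hrD : ∀ u ∈ Set.Icc (t - η) t, r u * ‖D u‖ ≤ Q * |y| := by
    intro u hu
    have hpos : 0 < a * Real.exp u := by positivity
    calc r u * ‖D u‖ ≤ Q * (a * Real.exp u) * (|y| / (a * Real.exp u)) :=
          mul_le_mul (hr2 u (hK u hu).1) (hDb u) (norm_nonneg _) (by positivity)
      _ = Q * |y| := by field_simp
  have hS'b : ∀ u ∈ Set.Icc (t - η) t, ‖-(I * y * D u)‖ ≤ |y| * (|y| / a) := by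
    intro u hu
    rw [norm_neg, norm_mul, norm_mul, Complex.norm_I, one_mul, Complex.norm_real,
      Real.norm_eq_abs]
    exact mul_le_mul_of_nonneg_left (hDu u hu) (abs_nonneg _)
  have hD'b : ∀ u ∈ Set.Icc (t - η) t,
      ‖-(I * y * S u) + 2 * (r u : ℂ) * D u‖ ≤ 2 * |y| + 2 * (Q * |y|) := by
    intro u hu
    refine (norm_add_le _ _).trans ?_
    rw [norm_neg, norm_mul, norm_mul, Complex.norm_I, one_mul, Complex.norm_real,
      Real.norm_eq_abs, norm_mul, norm_mul, Complex.norm_real, Real.norm_eq_abs,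
      abs_of_nonneg (hru u hu).1, Complex.norm_two]
    have h1 := hrD u hu
    have h2 : |y| * ‖S u‖ ≤ |y| * 2 := mul_le_mul_of_nonneg_left (hSb u) (abs_nonneg _)
    nlinarith
  have hr'b : ∀ u ∈ Set.Icc (t - η) t,
      ‖r u ^ 2 - (a * Real.exp u) ^ 2‖ ≤ (Q * (a * Real.exp t)) ^ 2 := by
    intro u hu
    have h1 : (a * Real.exp u) ^ 2 ≤ r u ^ 2 := pow_le_pow_left₀ (by positivity) (hr1 u) 2
    have h2 : r u ^ 2 ≤ (Q * (a * Real.exp t)) ^ 2 :=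
      pow_le_pow_left₀ (hru u hu).1 (hru u hu).2 2
    rw [Real.norm_eq_abs, abs_of_nonneg (sub_nonneg.2 h1)]
    nlinarith [sq_nonneg (a * Real.exp u)]
  refine ⟨fun u hu => norm_sub_right_le_of_deriv hS hS'b hu,
    fun u hu => norm_sub_right_le_of_deriv hD hD'b hu, fun u hu => ?_, hru, hDu⟩
  have h := norm_sub_right_le_of_deriv hr hr'b hu
  rwa [Real.norm_eq_abs] at h

/-- Taylor remainders of `S` and `D` over one step `[t − η, t]` (with `v = a e^t`):
`‖S(t−η) − (S t − ηS′(t))‖ ≤ 2(1+Q)y² η²` and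
`‖D(t−η) − (D t − ηD′(t))‖ ≤ (|y|³/a) η² + (4Q(1+Q) + 2Q²)|y| η² v`; also `v‖D t‖ ≤ |y|`.
[folklore] -/
private theorem window_taylor (a Q y : ℝ) (ha : 0 < a) (hQ : 1 ≤ Q) (S D : ℝ → ℂ) (r : ℝ → ℝ)
    (hS : ∀ t : ℝ, HasDerivAt S (-(I * y * D t)) t)
    (hD : ∀ t : ℝ, HasDerivAt D (-(I * y * S t) + 2 * (r t : ℂ) * D t) t)
    (hr : ∀ t : ℝ, HasDerivAt r (r t ^ 2 - (a * Real.exp t) ^ 2) t)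
    (hSb : ∀ t : ℝ, ‖S t‖ ≤ 2) (hDb : ∀ t : ℝ, ‖D t‖ ≤ |y| / (a * Real.exp t))
    (hr1 : ∀ t : ℝ, a * Real.exp t ≤ r t) (hr2 : ∀ t : ℝ, 0 ≤ t → r t ≤ Q * (a * Real.exp t))
    {η t : ℝ} (hη : 0 < η) (hηt : η ≤ t) :
    ‖S (t - η) - (S t - (η : ℂ) * -(I * y * D t))‖ ≤ |y| * (2 * |y| + 2 * (Q * |y|)) * η * η ∧
    (‖D (t - η) - (D t - (η : ℂ) * (-(I * y * S t) + 2 * (r t : ℂ) * D t))‖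
      ≤ |y| * (|y| * (|y| / a)) * η ^ 2
        + (2 * Q * (2 * |y| + 2 * (Q * |y|)) + 2 * Q ^ 2 * |y|) * η ^ 2 * (a * Real.exp t)) ∧
    a * Real.exp t * ‖D t‖ ≤ |y| := by
  obtain ⟨M1, M2, M3, hru, -⟩ := window_mvt a Q y ha hQ S D r hS hD hr hSb hDb hr1 hr2 hηt
  obtain ⟨CD, hCD⟩ : ∃ CD : ℝ, CD = 2 * |y| + 2 * (Q * |y|) := ⟨_, rfl⟩
  obtain ⟨CS, hCS⟩ : ∃ CS : ℝ, CS = |y| * (|y| / a) := ⟨_, rfl⟩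
  obtain ⟨v, hv⟩ : ∃ v : ℝ, v = a * Real.exp t := ⟨_, rfl⟩
  have hQ0 : 0 ≤ Q := by linarith
  have hCD0 : 0 ≤ CD := by rw [hCD]; positivity
  have hCS0 : 0 ≤ CS := by rw [hCS]; positivity
  rw [← hCD] at M2 ⊢
  rw [← hCS] at M1 ⊢
  rw [← hv] at M3 hru ⊢
  have hv0 : 0 < v := by rw [hv]; positivity
  have hvD : v * ‖D t‖ ≤ |y| := by
    have h := hDb t
    rw [← hv, le_div_iff₀ hv0] at h
    linarith
  have htu : ∀ u ∈ Set.Icc (t - η) t, t - u ≤ η := fun u hu => by linarith [hu.1]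
  refine ⟨?_, ?_, hvD⟩
  · refine norm_taylor_le_of_deriv (f := S) (f' := fun u => -(I * y * D u)) (B := |y| * CD * η)
      hη.le hS fun u hu => ?_
    have e : -(I * ↑y * D u) - -(I * ↑y * D t) = -(I * y * (D u - D t)) := by ring
    rw [e, norm_neg, norm_mul, norm_mul, Complex.norm_I, one_mul, Complex.norm_real,
      Real.norm_eq_abs]
    calc |y| * ‖D u - D t‖ ≤ |y| * (CD * (t - u)) :=
          mul_le_mul_of_nonneg_left (M2 u hu) (abs_nonneg _)
      _ ≤ |y| * (CD * η) :=
          mul_le_mul_of_nonneg_left (mul_le_mul_of_nonneg_left (htu u hu) hCD0) (abs_nonneg _)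
      _ = |y| * CD * η := by ring
  · have T2 : ‖D (t - η) - (D t - (η : ℂ) * (-(I * y * S t) + 2 * (r t : ℂ) * D t))‖
        ≤ η * (|y| * CS + 2 * (Q * v * CD + (Q * v) ^ 2 * ‖D t‖)) * η := by
      refine norm_taylor_le_of_deriv (f := D) (f' := fun u => -(I * y * S u) + 2 * (r u : ℂ) * D u)
        (B := η * (|y| * CS + 2 * (Q * v * CD + (Q * v) ^ 2 * ‖D t‖))) hη.le hD fun u hu => ?_
      have e : (-(I * ↑y * S u) + 2 * (r u : ℂ) * D u) - (-(I * ↑y * S t) + 2 * (r t : ℂ) * D t)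
          = -(I * y * (S u - S t))
            + 2 * ((r u : ℂ) * (D u - D t) + ((r u - r t : ℝ) : ℂ) * D t) := by
        push_cast; ring
      rw [e]
      refine (norm_add_le _ _).trans ?_
      rw [norm_neg, norm_mul, norm_mul, Complex.norm_I, one_mul, Complex.norm_real,
        Real.norm_eq_abs, norm_mul, Complex.norm_two]
      have h0 : ‖(r u : ℂ) * (D u - D t) + ((r u - r t : ℝ) : ℂ) * D t‖
          ≤ |r u| * ‖D u - D t‖ + |r u - r t| * ‖D t‖ := by
        refine (norm_add_le _ _).trans ?_
        rw [norm_mul, norm_mul, Complex.norm_real, Complex.norm_real, Real.norm_eq_abs,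
          Real.norm_eq_abs]
      have h1 : |y| * ‖S u - S t‖ ≤ |y| * CS * η := by
        calc |y| * ‖S u - S t‖ ≤ |y| * (CS * (t - u)) :=
              mul_le_mul_of_nonneg_left (M1 u hu) (abs_nonneg _)
          _ ≤ |y| * (CS * η) :=
              mul_le_mul_of_nonneg_left (mul_le_mul_of_nonneg_left (htu u hu) hCS0) (abs_nonneg _)
          _ = _ := by ring
      have h2 : |r u| * ‖D u - D t‖ ≤ Q * v * CD * η := by
        rw [abs_of_nonneg (hru u hu).1]
        calc r u * ‖D u - D t‖ ≤ Q * v * (CD * (t - u)) :=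
              mul_le_mul (hru u hu).2 (M2 u hu) (norm_nonneg _) (by positivity)
          _ ≤ Q * v * (CD * η) :=
              mul_le_mul_of_nonneg_left (mul_le_mul_of_nonneg_left (htu u hu) hCD0) (by positivity)
          _ = _ := by ring
      have h3 : |r u - r t| * ‖D t‖ ≤ (Q * v) ^ 2 * η * ‖D t‖ := by
        refine mul_le_mul_of_nonneg_right ?_ (norm_nonneg _)
        calc |r u - r t| ≤ (Q * v) ^ 2 * (t - u) := M3 u hu
          _ ≤ (Q * v) ^ 2 * η := mul_le_mul_of_nonneg_left (htu u hu) (by positivity)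
      nlinarith
    refine T2.trans ?_
    calc η * (|y| * CS + 2 * (Q * v * CD + (Q * v) ^ 2 * ‖D t‖)) * η
        = |y| * CS * η ^ 2 + 2 * Q * CD * η ^ 2 * v + 2 * Q ^ 2 * η ^ 2 * v * (v * ‖D t‖) := by
          ring
      _ ≤ |y| * CS * η ^ 2 + 2 * Q * CD * η ^ 2 * v + 2 * Q ^ 2 * η ^ 2 * v * |y| := by gcongr
      _ = _ := by ring

/-- Trigonometric bounds for the angle `x = yη` (`0 < η ≤ 1`): `|1 − cos x| ≤ y²η²/2`,
`|x − sin x| ≤ |y|³ η²`, `|sin x| ≤ |y| η`. [folklore] -/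
private theorem trig_bounds (y : ℝ) {η : ℝ} (hη : 0 < η) (hη1 : η ≤ 1) :
    |1 - Real.cos (y * η)| ≤ |y| ^ 2 * η ^ 2 / 2 ∧
      |y * η - Real.sin (y * η)| ≤ |y| ^ 3 * η ^ 2 ∧ |Real.sin (y * η)| ≤ |y| * η := by
  have habs : |y * η| = |y| * η := by rw [abs_mul, abs_of_pos hη]
  refine ⟨?_, (Real.abs_sub_sin_le _).trans ?_, habs ▸ Real.abs_sin_le_abs⟩
  · rw [abs_of_nonneg (sub_nonneg.2 (Real.cos_le_one _))]
    have e : (y * η) ^ 2 = |y| ^ 2 * η ^ 2 := by rw [mul_pow, sq_abs]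
    linarith [e ▸ Real.one_sub_sq_div_two_le_cos (x := y * η)]
  · rw [habs, mul_pow]
    have h3 : η ^ 3 ≤ η ^ 2 := pow_le_pow_of_le_one hη.le hη1 (by norm_num)
    have h0 : 0 ≤ |y| ^ 3 * η ^ 2 := by positivity
    nlinarith [mul_le_mul_of_nonneg_left h3 (by positivity : (0 : ℝ) ≤ |y| ^ 3)]

/-- First row of (transfer matrix) − (1 − ηA): with `x = yη`, `‖s‖ ≤ 2`, `a‖d‖, v‖d‖ ≤ |y|`,
`0 ≤ 1 − c ≤ w ≤ 2ηQv`:  `‖(1 − cos x) s + i(x − c sin x) d‖ ≤ (y² + y⁴/a + 2Qy²) η²`. [folklore] -/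
private theorem transfer_fst {y η Q v a c w : ℝ} {s d : ℂ} (hη : 0 < η) (hη1 : η ≤ 1)
    (hQ : 0 ≤ Q) (hs : ‖s‖ ≤ 2) (hd : ‖d‖ ≤ |y| / a) (hvd : v * ‖d‖ ≤ |y|) (hc1 : c ≤ 1)
    (h1c : 1 - c ≤ w) (hw0 : 0 ≤ w) (hwle : w ≤ 2 * η * (Q * v)) :
    ‖((1 - Real.cos (y * η) : ℝ) : ℂ) * s + I * ((y * η - c * Real.sin (y * η) : ℝ) : ℂ) * d‖
      ≤ (|y| ^ 2 + |y| ^ 4 / a + 2 * Q * |y| ^ 2) * η ^ 2 := by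
  obtain ⟨hcos, hsin, hsin1⟩ := trig_bounds y hη hη1
  have nA1 : ‖((1 - Real.cos (y * η) : ℝ) : ℂ) * s‖ ≤ |y| ^ 2 * η ^ 2 := by
    rw [norm_mul, Complex.norm_real, Real.norm_eq_abs]
    calc |1 - Real.cos (y * η)| * ‖s‖ ≤ (|y| ^ 2 * η ^ 2 / 2) * 2 :=
          mul_le_mul hcos hs (norm_nonneg _) (by positivity)
      _ = |y| ^ 2 * η ^ 2 := by ring
  have nA2 : ‖I * ((y * η - c * Real.sin (y * η) : ℝ) : ℂ) * d‖
      ≤ |y| ^ 4 / a * η ^ 2 + 2 * Q * |y| ^ 2 * η ^ 2 := by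
    rw [norm_mul, norm_mul, Complex.norm_I, one_mul, Complex.norm_real, Real.norm_eq_abs]
    have h1 : |y * η - c * Real.sin (y * η)| ≤ |y| ^ 3 * η ^ 2 + w * (|y| * η) := by
      have e : y * η - c * Real.sin (y * η)
          = (y * η - Real.sin (y * η)) + (1 - c) * Real.sin (y * η) := by ring
      rw [e]
      refine (abs_add_le _ _).trans (add_le_add hsin ?_)
      rw [abs_mul, abs_of_nonneg (by linarith)]
      exact mul_le_mul h1c hsin1 (abs_nonneg _) hw0
    calc |y * η - c * Real.sin (y * η)| * ‖d‖ ≤ (|y| ^ 3 * η ^ 2 + w * (|y| * η)) * ‖d‖ :=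
          mul_le_mul_of_nonneg_right h1 (norm_nonneg _)
      _ = |y| ^ 3 * η ^ 2 * ‖d‖ + w * (|y| * η) * ‖d‖ := by ring
      _ ≤ |y| ^ 3 * η ^ 2 * (|y| / a) + 2 * η * (Q * v) * (|y| * η) * ‖d‖ := by gcongr
      _ = |y| ^ 4 / a * η ^ 2 + 2 * Q * |y| * η ^ 2 * (v * ‖d‖) := by ring
      _ ≤ |y| ^ 4 / a * η ^ 2 + 2 * Q * |y| * η ^ 2 * |y| := by gcongr
      _ = |y| ^ 4 / a * η ^ 2 + 2 * Q * |y| ^ 2 * η ^ 2 := by ring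
  exact (norm_add_le _ _).trans ((add_le_add nA1 nA2).trans (le_of_eq (by ring)))

/-- Second row of (transfer matrix) − (1 − ηA): with `x = yη`, `‖s‖ ≤ 2`, `a‖d‖, v‖d‖ ≤ |y|`,
`0 ≤ c ≤ 1`, `|1 − c − w| ≤ w²`, `0 ≤ w ≤ 2ηQv`, `|ρ| ≤ (Qv)²η` (`ρ = r(t−η) − r(t)`):
`‖i(x − sin x) s + c(1 − cos x) d + (1 − c − w) d + 2ηρ d‖ ≤ (2|y|³ + |y|³/2a) η² + 6Q²|y| η² v`.
[folklore] -/
private theorem transfer_snd {y η Q v a c w ρ : ℝ} {s d : ℂ} (hη : 0 < η) (hη1 : η ≤ 1)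
    (hv : 0 ≤ v) (hs : ‖s‖ ≤ 2) (hd : ‖d‖ ≤ |y| / a) (hvd : v * ‖d‖ ≤ |y|) (hc0 : 0 ≤ c)
    (hc1 : c ≤ 1) (hcw : |1 - c - w| ≤ w ^ 2) (hw0 : 0 ≤ w) (hwle : w ≤ 2 * η * (Q * v))
    (hρ : |ρ| ≤ (Q * v) ^ 2 * η) :
    ‖I * ((y * η - Real.sin (y * η) : ℝ) : ℂ) * s + ((c * (1 - Real.cos (y * η)) : ℝ) : ℂ) * d
        + (((1 - c - w : ℝ) : ℂ) * d + ((2 * η * ρ : ℝ) : ℂ) * d)‖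
      ≤ (2 * |y| ^ 3 + |y| ^ 3 / (2 * a)) * η ^ 2 + 6 * Q ^ 2 * |y| * η ^ 2 * v := by
  obtain ⟨hcos, hsin, -⟩ := trig_bounds y hη hη1
  have nB1 : ‖I * ((y * η - Real.sin (y * η) : ℝ) : ℂ) * s‖ ≤ 2 * |y| ^ 3 * η ^ 2 := by
    rw [norm_mul, norm_mul, Complex.norm_I, one_mul, Complex.norm_real, Real.norm_eq_abs]
    calc |y * η - Real.sin (y * η)| * ‖s‖ ≤ |y| ^ 3 * η ^ 2 * 2 :=
          mul_le_mul hsin hs (norm_nonneg _) (by positivity)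
      _ = _ := by ring
  have nB2 : ‖((c * (1 - Real.cos (y * η)) : ℝ) : ℂ) * d‖ ≤ |y| ^ 3 / (2 * a) * η ^ 2 := by
    rw [norm_mul, Complex.norm_real, Real.norm_eq_abs, abs_mul, abs_of_nonneg hc0]
    calc c * |1 - Real.cos (y * η)| * ‖d‖ ≤ 1 * (|y| ^ 2 * η ^ 2 / 2) * (|y| / a) := by
          gcongr
      _ = _ := by ring
  have nB34 : ‖((1 - c - w : ℝ) : ℂ) * d + ((2 * η * ρ : ℝ) : ℂ) * d‖
      ≤ 6 * Q ^ 2 * |y| * η ^ 2 * v := by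
    refine (norm_add_le _ _).trans ?_
    rw [norm_mul, Complex.norm_real, Real.norm_eq_abs, norm_mul, Complex.norm_real,
      Real.norm_eq_abs, abs_mul, abs_of_nonneg (by positivity : (0 : ℝ) ≤ 2 * η)]
    have hw2 : w ^ 2 ≤ (2 * η * (Q * v)) ^ 2 := pow_le_pow_left₀ hw0 hwle 2
    calc |1 - c - w| * ‖d‖ + 2 * η * |ρ| * ‖d‖
        ≤ w ^ 2 * ‖d‖ + 2 * η * ((Q * v) ^ 2 * η) * ‖d‖ := by gcongr
      _ ≤ (2 * η * (Q * v)) ^ 2 * ‖d‖ + 2 * η * ((Q * v) ^ 2 * η) * ‖d‖ := by gcongr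
      _ = 6 * Q ^ 2 * η ^ 2 * v * (v * ‖d‖) := by ring
      _ ≤ 6 * Q ^ 2 * η ^ 2 * v * |y| := by gcongr
      _ = _ := by ring
  exact norm_add₃_le.trans ((add_le_add_three nB1 nB2 nB34).trans (le_of_eq (by ring)))

/-- **Second-order consistency of one Euler (transfer) step** for the telegraph backward system
`S′ = −iyD`, `D′ = −iyS + 2rD` (`ae^t ≤ r ≤ Qae^t` on `t ≥ 0`, `r′ = r² − (ae^t)²`, `|S| ≤ 2`,
`|D| ≤ |y|/(ae^t)`): the exact flow over `[t − η, t]` and the transfer step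
`sdStep (iyη) (e^{−2ηr(t−η)})` differ by at most `L η² e^t` in each component, for a constant `L`
depending only on `a, Q, y`. [folklore] -/
theorem stub_localError (a Q y : ℝ) (ha : 0 < a) (hQ : 1 ≤ Q) (S D : ℝ → ℂ) (r : ℝ → ℝ)
    (hS : ∀ t : ℝ, HasDerivAt S (-(I * y * D t)) t)
    (hD : ∀ t : ℝ, HasDerivAt D (-(I * y * S t) + 2 * (r t : ℂ) * D t) t)
    (hr : ∀ t : ℝ, HasDerivAt r (r t ^ 2 - (a * Real.exp t) ^ 2) t)
    (hSb : ∀ t : ℝ, ‖S t‖ ≤ 2) (hDb : ∀ t : ℝ, ‖D t‖ ≤ |y| / (a * Real.exp t))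
    (hr1 : ∀ t : ℝ, a * Real.exp t ≤ r t) (hr2 : ∀ t : ℝ, 0 ≤ t → r t ≤ Q * (a * Real.exp t)) :
    ∃ L : ℝ, ∀ η t : ℝ, 0 < η → η ≤ 1 → η ≤ t →
      ‖S (t - η) - (sdStep (I * y * η) (Real.exp (-(2 * η * r (t - η)))) (S t, D t)).1‖
          ≤ L * η ^ 2 * Real.exp t ∧
      ‖D (t - η) - (sdStep (I * y * η) (Real.exp (-(2 * η * r (t - η)))) (S t, D t)).2‖
          ≤ L * η ^ 2 * Real.exp t := by
  -- The constant `L = L₁ + L₂` (first / second component): polynomials in `|y|, Q, a, 1/a`.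
  obtain ⟨L₁, hL₁⟩ : ∃ L₁ : ℝ,
      L₁ = |y| * (2 * |y| + 2 * (Q * |y|)) + (|y| ^ 2 + |y| ^ 4 / a + 2 * Q * |y| ^ 2) :=
    ⟨_, rfl⟩
  obtain ⟨L₂, hL₂⟩ : ∃ L₂ : ℝ,
      L₂ = |y| * (|y| * (|y| / a)) + (2 * |y| ^ 3 + |y| ^ 3 / (2 * a))
        + a * ((2 * Q * (2 * |y| + 2 * (Q * |y|)) + 2 * Q ^ 2 * |y|) + 6 * Q ^ 2 * |y|) :=
    ⟨_, rfl⟩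
  have hQ0 : 0 ≤ Q := by linarith
  have hL₁0 : 0 ≤ L₁ := by rw [hL₁]; positivity
  have hL₂0 : 0 ≤ L₂ := by rw [hL₂]; positivity
  refine ⟨L₁ + L₂, fun η t hη hη1 hηt => ?_⟩
  obtain ⟨T1, T2, hvD⟩ := window_taylor a Q y ha hQ S D r hS hD hr hSb hDb hr1 hr2 hη hηt
  obtain ⟨-, -, M3, hru, hDu⟩ := window_mvt a Q y ha hQ S D r hS hD hr hSb hDb hr1 hr2 hηt
  obtain ⟨hr0, hrQ⟩ := hru (t - η) ⟨le_rfl, by linarith⟩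
  have hρ := M3 (t - η) ⟨le_rfl, by linarith⟩
  rw [sub_sub_cancel] at hρ
  have hDt := hDu t ⟨by linarith, le_rfl⟩
  obtain ⟨v, hv⟩ : ∃ v : ℝ, v = a * Real.exp t := ⟨_, rfl⟩
  rw [← hv] at T2 hρ hrQ hvD
  have hv0 : 0 < v := by rw [hv]; positivity
  have hη2 : η ^ 2 ≤ η ^ 2 * Real.exp t :=
    le_mul_of_one_le_right (by positivity) (Real.one_le_exp (by linarith))
  -- The bond parameter `c = e^{-w}`, `w = 2η r(t - η)`.
  obtain ⟨w, hw⟩ : ∃ w : ℝ, w = 2 * η * r (t - η) := ⟨_, rfl⟩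
  obtain ⟨c, hc⟩ : ∃ c : ℝ, c = Real.exp (-w) := ⟨_, rfl⟩
  have hw0 : 0 ≤ w := by rw [hw]; positivity
  have hwle : w ≤ 2 * η * (Q * v) := by
    rw [hw]; exact mul_le_mul_of_nonneg_left hrQ (by positivity)
  have hc0 : 0 ≤ c := by rw [hc]; exact (Real.exp_pos _).le
  have hc1 : c ≤ 1 := by rw [hc, Real.exp_le_one_iff]; linarith
  have h1c : 1 - c ≤ w := by rw [hc]; linarith [Real.add_one_le_exp (-w)]
  have hcw : |1 - c - w| ≤ w ^ 2 := by
    rw [hc, show (1 : ℝ) - Real.exp (-w) - w = -(Real.exp (-w) - 1 + w) by ring, abs_neg]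
    exact abs_exp_neg_sub_le hw0
  have X1 := transfer_fst (y := y) (s := S t) (d := D t) hη hη1 hQ0 (hSb t) hDt hvD hc1 h1c hw0
    hwle
  have X2 := transfer_snd (y := y) (s := S t) (d := D t) hη hη1 hv0.le (hSb t) hDt hvD hc0 hc1
    hcw hw0 hwle hρ
  -- Unfold the transfer step and add up.
  obtain ⟨hcosh, hsinh⟩ := cosh_sinh_I_mul y η
  simp only [sdStep, hcosh, hsinh]
  rw [← hw, ← hc]
  constructor
  · have key : S (t - η) - (↑(Real.cos (y * η)) * S t + ↑c * (↑(Real.sin (y * η)) * I) * D t)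
        = (S (t - η) - (S t - (η : ℂ) * -(I * y * D t)))
          + (((1 - Real.cos (y * η) : ℝ) : ℂ) * S t
            + I * ((y * η - c * Real.sin (y * η) : ℝ) : ℂ) * D t) := by
      push_cast; ring
    rw [key]
    refine (norm_add_le _ _).trans ((add_le_add T1 X1).trans ?_)
    have hA : L₁ * η ^ 2 ≤ L₁ * (η ^ 2 * Real.exp t) := mul_le_mul_of_nonneg_left hη2 hL₁0
    have hB : 0 ≤ L₂ * (η ^ 2 * Real.exp t) := by positivity
    have e : |y| * (2 * |y| + 2 * (Q * |y|)) * η * η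
        + (|y| ^ 2 + |y| ^ 4 / a + 2 * Q * |y| ^ 2) * η ^ 2 = L₁ * η ^ 2 := by rw [hL₁]; ring
    linarith
  · have key : D (t - η) - (↑(Real.sin (y * η)) * I * S t + ↑c * ↑(Real.cos (y * η)) * D t)
        = (D (t - η) - (D t - (η : ℂ) * (-(I * y * S t) + 2 * (r t : ℂ) * D t)))
          + (I * ((y * η - Real.sin (y * η) : ℝ) : ℂ) * S t
            + ((c * (1 - Real.cos (y * η)) : ℝ) : ℂ) * D t
            + (((1 - c - w : ℝ) : ℂ) * D t + ((2 * η * (r (t - η) - r t) : ℝ) : ℂ) * D t)) := by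
      rw [hw]; push_cast; ring
    rw [key]
    refine (norm_add_le _ _).trans ((add_le_add T2 X2).trans ?_)
    have hA : (|y| * (|y| * (|y| / a)) + (2 * |y| ^ 3 + |y| ^ 3 / (2 * a))) * η ^ 2
        ≤ (|y| * (|y| * (|y| / a)) + (2 * |y| ^ 3 + |y| ^ 3 / (2 * a))) * (η ^ 2 * Real.exp t) :=
      mul_le_mul_of_nonneg_left hη2 (by positivity)
    have hB : 0 ≤ L₁ * (η ^ 2 * Real.exp t) := by positivity
    rw [hv, hL₂]
    linarith

end Summit.RiemannHypothesis.RiemannHypothesis.Theorems.LeeYangTelegraph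

end
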